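import Summits.QuantumFields.YangMills.Theorems.ConvexGribovBodyNonSimplyConnectedLatticeGapStubCruxOfMeanBoxInfluenceDecayNSC
import HarnessLib

/-!
# `NonSimplyConnectedLatticeGap` — the transfer of line `Sketch` v11: AVERAGED weak mixing on cubes of diameter at
# most half the torus ⇒ crux (stub `stub_cruxOfMeanBoxInfluenceDecayHalfTorusNSC` (T‴) of crux
# stmt-QuantumFields-16405, route `ConvexGribovBody`)

The v9 transfer T″ (`stub_cruxOfMeanBoxInfluenceDecayNSC`, p132611) derived the crux from the `L¹(μ_S)` oscillation
bound `∫ |γ_{Λ_L}(A | Ũ) − μ_S(A)| dμ_S(U) ≤ C_A e^{−mL}` of the cube kernels at periodic lifts `Ũ = torusLift V`,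
`μ_S = wilsonMeasure r.ρ β` on `(2S+1)⁴`, for ALL cubes `Λ_L = [−L,L]⁴ × univ ⊇ supp A` with `L + 1 ≤ S`. The v11
leaf A‴ supplies this bound only for the cubes of diameter at most half the torus, `2L + 1 ≤ S` (the regime of
reflection positivity and chessboard estimates on the odd torus). The transfer is the same far-factor DLR argument
(`abs_latticeConnectedCorr_le_mul_meanBoxInfluence`) with the cube radius `L = ⌊(t − R_B − 1)/2⌋` instead of
`t − R_B − 1`: then `2L + 1 ≤ t − R_B ≤ t ≤ S`, the cube still contains `supp A` once `t ≥ 2R_A + R_B + 3`, it still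
injects into the torus with its collar and still misses the time-`t` translate of `supp B`; only the rate halves,
`e^{−mL} ≤ e^{m(R_B+2)/2} e^{−(m/2)t}`.

* `clustering_of_meanBoxInfluenceDecayHalfTorus_at` — the core transfer at fixed `(G, ρ, β, m)`, rate `m ↦ m/2`.
* `stub_cruxOfMeanBoxInfluenceDecayHalfTorusNSC` — the registered stub T‴ (`S₁ = 0`).

References: H.-O. Georgii, *Gibbs Measures and Phase Transitions*, 2nd ed. (de Gruyter 2011), Prop. 2.5, Thm. 4.17,
§8.2; F. Martinelli, LNM 1717 (1999), §2.3.
-/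

set_option autoImplicit false

noncomputable section

open MeasureTheory Filter
open Literature.Probability.LatticeModels
open Literature.MathematicalPhysics.QuantumLattice
open Literature.MathematicalPhysics.QuantumFieldTheory (wilsonMeasure isProbabilityMeasure_wilsonMeasure
  latticeConnectedCorr GaugeConfig LatticeRep YMSpecies IsCompactSimpleLieGroup)

namespace Summit.QuantumFields.YangMills.Theorems.NonSimplyConnectedLatticeGap

/-! ## The core transfer at fixed `(G, ρ, β, m)`: half-torus cubes, rate `m/2` -/

section Core

variable {N : ℕ} {G : Type} [Group G] [TopologicalSpace G] [IsTopologicalGroup G]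
  [CompactSpace G] [MeasurableSpace G] [BorelSpace G] [SecondCountableTopology G] [T2Space G]
  (ρ : G →* Matrix (Fin N) (Fin N) ℂ)

/-- **Averaged weak mixing on half-torus cubes ⇒ volume-uniform torus clustering at half the rate** (every compact
metrisable `G`, every continuous representation `ρ`, every `β`, every rate `m ≥ 0`). If for every gauge-invariant
local observable `A` there is `C_A` with `∫ |γ_{Λ_L}(A | Ũ) − μ_S(A)| dμ_S(U) ≤ C_A e^{−mL}` for all cubes
`Λ_L = [−L,L]⁴ × univ` containing the support of `A` and all tori `(2S+1)⁴` with `2L + 1 ≤ S`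
(`μ_S = wilsonMeasure ρ β`), then for all `A, B` there is `C` with `|⟨A; τ_t B⟩_{β,2S+1}| ≤ C e^{−(m/2)t}` for all
`S` and all `t ≤ S`. Proof: for `t ≥ 2R_A + R_B + 3` the cube of radius `L = ⌊(t − R_B − 1)/2⌋ ≥ R_A + 1` contains
the support of `A`, satisfies `2L + 1 ≤ t − R_B ≤ S`, injects into the torus with its collar (`L + 1 ≤ S`) and misses
the support of `τ_t B` (`L + R_B + 1 ≤ t`, `L + R_B + t ≤ 2S − 1`), so
`abs_latticeConnectedCorr_le_mul_meanBoxInfluence` bounds the correlation by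
`‖B‖∞ C_A e^{−mL} ≤ ‖B‖∞ C_A e^{m(R_B+2)/2} e^{−(m/2)t}` (as `2L + 2 ≥ t − R_B`); for smaller `t` use
`|corr| ≤ 2‖A‖∞‖B‖∞`. -/
theorem clustering_of_meanBoxInfluenceDecayHalfTorus_at (hρ : Continuous ρ) (β : ℝ) {m : ℝ} (hm : 0 ≤ m)
    (hMM : ∀ A : LocalGaugeObservable 4 G, ∃ C : ℝ, ∀ (L S : ℕ),
      A.supp ⊆ ((Fintype.piFinset fun _ : Fin 4 => Finset.Icc (-((L : ℕ) : ℤ)) ((L : ℕ) : ℤ)) ×ˢ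
        (Finset.univ : Finset (Fin 4))) → 2 * L + 1 ≤ S →
      ∫ V, |(∫ U, A.F U ∂(ymSpecification ρ β ((Fintype.piFinset fun _ : Fin 4 =>
          Finset.Icc (-((L : ℕ) : ℤ)) ((L : ℕ) : ℤ)) ×ˢ (Finset.univ : Finset (Fin 4)))
          (torusLift (2 * S + 1) V))) -
        ∫ W, A.F (torusLift (2 * S + 1) W) ∂(wilsonMeasure (d := 4) (L := 2 * S + 1) ρ β)|
        ∂(wilsonMeasure (d := 4) (L := 2 * S + 1) ρ β) ≤ C * Real.exp (-(m * L)))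
    (A B : LocalGaugeObservable 4 G) :
    ∃ C : ℝ, ∀ S t : ℕ, t ≤ S →
      |latticeConnectedCorr ρ β (2 * S + 1) A.F B.F t| ≤ C * Real.exp (-(m / 2 * t)) := by
  -- adapted from `clustering_of_meanBoxInfluenceDecay_at` (T″, p132611): cube radius `L = (t − R_B − 1) / 2`
  obtain ⟨CA, hCA⟩ := A.bounded
  obtain ⟨CB, hCB⟩ := B.bounded
  have hCA0 : 0 ≤ CA := (abs_nonneg _).trans (hCA fun _ => 1)
  have hCB0 : 0 ≤ CB := (abs_nonneg _).trans (hCB fun _ => 1)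
  have hm2 : 0 ≤ m / 2 := div_nonneg hm zero_le_two
  -- the radii of the supports
  set RA : ℕ := A.supp.sup fun e => Finset.univ.sup fun i => (e.1 i).natAbs
  set RB : ℕ := B.supp.sup fun e => Finset.univ.sup fun i => (e.1 i).natAbs
  have hRA : ∀ e ∈ A.supp, ∀ i, |e.1 i| ≤ RA := fun e he i => by
    rw [Int.abs_eq_natAbs, Int.ofNat_le]
    exact (Finset.le_sup (f := fun i => (e.1 i).natAbs) (Finset.mem_univ i)).trans
      (Finset.le_sup (f := fun e : ZdEdge 4 => Finset.univ.sup fun i => (e.1 i).natAbs) he)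
  have hRB : ∀ e ∈ B.supp, ∀ i, |e.1 i| ≤ RB := fun e he i => by
    rw [Int.abs_eq_natAbs, Int.ofNat_le]
    exact (Finset.le_sup (f := fun i => (e.1 i).natAbs) (Finset.mem_univ i)).trans
      (Finset.le_sup (f := fun e : ZdEdge 4 => Finset.univ.sup fun i => (e.1 i).natAbs) he)
  clear_value RA RB
  -- the mean cube-influence constant of `A`, made non-negative
  obtain ⟨KA₀, hKA⟩ := hMM A
  set KA : ℝ := max KA₀ 0 with hKAdef
  have hKA0 : 0 ≤ KA := le_max_right _ _
  have hKA1 : KA₀ ≤ KA := le_max_left _ _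
  clear_value KA
  -- the constant
  refine ⟨2 * CA * CB * Real.exp (m / 2 * (2 * RA + RB + 3)) +
    CB * KA * Real.exp (m / 2 * (RB + 2)), ?_⟩
  intro S t ht
  haveI := isProbabilityMeasure_wilsonMeasure (d := 4) (L := 2 * S + 1) ρ hρ β
  -- the trivial bound
  have htriv : |latticeConnectedCorr ρ β (2 * S + 1) A.F B.F t| ≤ 2 * CA * CB := by
    unfold Literature.MathematicalPhysics.QuantumFieldTheory.latticeConnectedCorr
    have h1 : |∫ U, A.F (torusLift (2 * S + 1) U) *
        B.F (Literature.MathematicalPhysics.QuantumLattice.configShift (-Pi.single 0 (t : ℤ))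
          (torusLift (2 * S + 1) U)) ∂(wilsonMeasure (d := 4) (L := 2 * S + 1) ρ β)| ≤
        CA * CB :=
      abs_integral_le_of_abs_le fun U => by
        rw [abs_mul]
        exact mul_le_mul (hCA _) (hCB _) (abs_nonneg _) hCA0
    have h2 : |∫ U, A.F (torusLift (2 * S + 1) U) ∂(wilsonMeasure (d := 4) (L := 2 * S + 1) ρ β)|
        ≤ CA := abs_integral_le_of_abs_le fun U => hCA _
    have h3 : |∫ U, B.F (torusLift (2 * S + 1) U) ∂(wilsonMeasure (d := 4) (L := 2 * S + 1) ρ β)|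
        ≤ CB := abs_integral_le_of_abs_le fun U => hCB _
    calc _ ≤ |∫ U, A.F (torusLift (2 * S + 1) U) *
          B.F (Literature.MathematicalPhysics.QuantumLattice.configShift (-Pi.single 0 (t : ℤ))
            (torusLift (2 * S + 1) U)) ∂(wilsonMeasure (d := 4) (L := 2 * S + 1) ρ β)| +
          |(∫ U, A.F (torusLift (2 * S + 1) U) ∂(wilsonMeasure (d := 4) (L := 2 * S + 1) ρ β)) *
            ∫ U, B.F (torusLift (2 * S + 1) U) ∂(wilsonMeasure (d := 4) (L := 2 * S + 1) ρ β)| :=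
          abs_sub _ _
      _ ≤ CA * CB + CA * CB := by
          rw [abs_mul]
          exact add_le_add h1 (mul_le_mul h2 h3 (abs_nonneg _) hCA0)
      _ = 2 * CA * CB := by ring
  by_cases hcase : 2 * RA + RB + 3 ≤ t
  swap
  · -- the supports are close in time: the trivial bound suffices
    have htle : (t : ℝ) ≤ 2 * RA + RB + 3 := by exact_mod_cast (not_le.1 hcase).le
    have hexp : 1 ≤ Real.exp (m / 2 * (2 * RA + RB + 3)) * Real.exp (-(m / 2 * t)) := by
      rw [← Real.exp_add]
      refine Real.one_le_exp ?_
      have h := mul_le_mul_of_nonneg_left htle hm2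
      linarith only [h]
    calc |latticeConnectedCorr ρ β (2 * S + 1) A.F B.F t| ≤ 2 * CA * CB := htriv
      _ = 2 * CA * CB * 1 + 0 := by ring
      _ ≤ 2 * CA * CB * (Real.exp (m / 2 * (2 * RA + RB + 3)) * Real.exp (-(m / 2 * t))) +
            CB * KA * Real.exp (m / 2 * (RB + 2)) * Real.exp (-(m / 2 * t)) := by
          gcongr
          positivity
      _ = (2 * CA * CB * Real.exp (m / 2 * (2 * RA + RB + 3)) +
            CB * KA * Real.exp (m / 2 * (RB + 2))) * Real.exp (-(m / 2 * t)) := by ring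
  · -- the main case: the cube of radius `L = ⌊(t - R_B - 1) / 2⌋` with its collar fits strictly between
    -- the support of `A` and the time-`t` translate of the support of `B`, and `2L + 1 ≤ t - R_B ≤ S`
    obtain ⟨L, hL⟩ : ∃ L : ℕ, L = (t - RB - 1) / 2 := ⟨_, rfl⟩
    have hLt : L + RB + 1 ≤ t := by omega
    have hLt2 : t ≤ 2 * L + RB + 2 := by omega
    have hRAL : RA + 1 ≤ L := by omega
    have hLS : L + 1 ≤ S := by omega
    have h2LS : 2 * L + 1 ≤ S := by omega
    -- integer forms of the separation facts
    have hI1 : (L : ℤ) + RB + 1 ≤ t := by exact_mod_cast hLt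
    have hI2 : (t : ℤ) ≤ S := by exact_mod_cast ht
    have hRAL' : (RA : ℤ) + 1 ≤ L := by exact_mod_cast hRAL
    have hLS' : (L : ℤ) + 1 ≤ S := by exact_mod_cast hLS
    -- the cube `Λ` of radius `L`
    obtain ⟨Λ, hΛ⟩ : ∃ Λ : Finset (ZdEdge 4), Λ = (Fintype.piFinset fun _ : Fin 4 =>
      Finset.Icc (-((L : ℕ) : ℤ)) ((L : ℕ) : ℤ)) ×ˢ (Finset.univ : Finset (Fin 4)) := ⟨_, rfl⟩
    have hmemΛ : ∀ e ∈ Λ, ∀ i, -(L : ℤ) ≤ e.1 i ∧ e.1 i ≤ L := by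
      intro e he i
      rw [hΛ, Finset.mem_product, Fintype.mem_piFinset] at he
      exact Finset.mem_Icc.1 (he.1 i)
    -- (o) the cube contains the support of `A`
    have hsuppΛ : A.supp ⊆ Λ := by
      intro e he
      rw [hΛ, Finset.mem_product, Fintype.mem_piFinset]
      refine ⟨fun i => Finset.mem_Icc.2 ?_, Finset.mem_univ _⟩
      have h := abs_le.1 (hRA e he i)
      constructor <;> linarith only [h.1, h.2, hRAL']
    -- (i) `Λ`, the support of `A` and the collar of `Λ` inject into the torus
    have hwide : ∀ e ∈ Λ ∪ A.supp ∪ (plaquettesTouching Λ).biUnion plaquetteEdges, ∀ i,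
        -(L : ℤ) - 1 ≤ e.1 i ∧ e.1 i ≤ L + 1 := by
      intro e he i
      simp only [Finset.mem_union] at he
      rcases he with (he | he) | he
      · have h := hmemΛ e he i
        constructor <;> linarith only [h.1, h.2]
      · have h := abs_le.1 (hRA e he i)
        constructor <;> linarith only [h.1, h.2, hRAL']
      · obtain ⟨e', he', hn'⟩ := exists_near_of_mem_collar he
        have h := hmemΛ e' he' i
        have h' := hn' i
        constructor <;> linarith only [h.1, h.2, h'.1, h'.2]
    have hinj : Set.InjOn (Torus.proj (2 * S + 1))
        ((Λ ∪ A.supp ∪ (plaquettesTouching Λ).biUnion plaquetteEdges).image Prod.fst :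
          Set (Site 4)) := by
      refine (FiniteSizeCriterion.injOn_torusProj_of_width (M := 2 * S + 1) (lo := -(L : ℤ) - 1)
        (hi := (L : ℤ) + 1) (by push_cast; linarith only [hLS'])).mono fun x hx => ?_
      obtain ⟨e, he, rfl⟩ := Finset.mem_image.1 (Finset.mem_coe.1 hx)
      exact hwide e he
    -- (ii) the torus image of `Λ` misses the translate of the support of `B`
    have hfar : ∀ e ∈ B.supp.image (fun e : ZdEdge 4 => (e.1 - -Pi.single 0 (t : ℤ), e.2)),
        ∀ e' ∈ Λ, torusEdge (2 * S + 1) e ≠ torusEdge (2 * S + 1) e' := by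
      intro e he e' he' heq
      obtain ⟨e₀, he₀, rfl⟩ := Finset.mem_image.1 he
      have h0 := abs_le.1 (hRB e₀ he₀ 0)
      have h1 := hmemΛ e' he' 0
      have hproj : ((e₀.1 0 + t : ℤ) : ZMod (2 * S + 1)) = ((e'.1 0 : ℤ) : ZMod (2 * S + 1)) := by
        have h := congr_fun (congr_arg Prod.fst heq) 0
        simp only [torusEdge] at h
        simpa [Torus.proj_apply] using h
      rw [ZMod.intCast_eq_intCast_iff_dvd_sub] at hproj
      -- `0 < (e₀.1 0 + t) - e'.1 0 < 2S+1`, contradicting divisibility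
      have hpos : 0 < e₀.1 0 + t - e'.1 0 := by linarith only [h0.1, h1.2, hI1]
      have hlt' : e₀.1 0 + t - e'.1 0 < ((2 * S + 1 : ℕ) : ℤ) := by
        push_cast; linarith only [h0.2, h1.1, hI1, hI2]
      have hdvd : (((2 * S + 1 : ℕ) : ℤ)) ∣ e₀.1 0 + t - e'.1 0 := by
        have h := hproj
        rwa [← neg_sub, dvd_neg] at h
      exact absurd (Int.le_of_dvd hpos hdvd) (not_le.2 hlt')
    -- (iii) the MEAN cube-influence bound on the torus (half-torus cube: `2L + 1 ≤ S`) and the covariance bound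
    have hmean := hKA L S (by rw [← hΛ]; exact hsuppΛ) h2LS
    rw [← hΛ] at hmean
    have hcov := abs_latticeConnectedCorr_le_mul_meanBoxInfluence ρ hρ β (M := 2 * S + 1) Λ
      A.measurable B.measurable hCA hCB A.isCylinder B.isCylinder t hinj hfar
    have hfin : |latticeConnectedCorr ρ β (2 * S + 1) A.F B.F t| ≤
        CB * (KA * Real.exp (-(m * L))) :=
      hcov.trans (mul_le_mul_of_nonneg_left
        (hmean.trans (mul_le_mul_of_nonneg_right hKA1 (Real.exp_pos _).le)) hCB0)
    -- (iv) compare with `C e^{−(m/2) t}` using `2L + R_B + 2 ≥ t`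
    have hLr : (t : ℝ) ≤ 2 * L + RB + 2 := by exact_mod_cast hLt2
    have hexp : Real.exp (-(m * L)) ≤ Real.exp (m / 2 * (RB + 2)) * Real.exp (-(m / 2 * t)) := by
      rw [← Real.exp_add, Real.exp_le_exp]
      have h := mul_le_mul_of_nonneg_left hLr hm
      linarith only [h]
    calc |latticeConnectedCorr ρ β (2 * S + 1) A.F B.F t| ≤ CB * (KA * Real.exp (-(m * L))) := hfin
      _ ≤ CB * (KA * (Real.exp (m / 2 * (RB + 2)) * Real.exp (-(m / 2 * t)))) :=
          mul_le_mul_of_nonneg_left (mul_le_mul_of_nonneg_left hexp hKA0) hCB0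
      _ = 0 + CB * KA * Real.exp (m / 2 * (RB + 2)) * Real.exp (-(m / 2 * t)) := by ring
      _ ≤ 2 * CA * CB * Real.exp (m / 2 * (2 * RA + RB + 3)) * Real.exp (-(m / 2 * t)) +
            CB * KA * Real.exp (m / 2 * (RB + 2)) * Real.exp (-(m / 2 * t)) := by
          gcongr
          positivity
      _ = (2 * CA * CB * Real.exp (m / 2 * (2 * RA + RB + 3)) +
            CB * KA * Real.exp (m / 2 * (RB + 2))) * Real.exp (-(m / 2 * t)) := by ring

end Core

/-! ## The registered transfer T‴ -/

/-- **STUB T‴ — averaged weak mixing on half-torus cubes at large `β` for `π₁(G) ≠ 0` ⇒ `NonSimplyConnectedLatticeGap`**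
(registered stub `stub_cruxOfMeanBoxInfluenceDecayHalfTorusNSC` of the skeleton
`Cruxes/NonSimplyConnectedLatticeGap/Lines/Sketch.lean` v11 of item stmt-QuantumFields-16405). Far-factor DLR on the
torus in `L¹` form: `⟨A; τ_t B⟩_S = ∫ (γ_{Λ_L}A(Ũ) − μ_S(A)) · τ_tB(Ũ) dμ_S` with `L = ⌊(t − R_B − 1)/2⌋`, so that
`2L + 1 ≤ t ≤ S` and `|⟨A; τ_t B⟩_S| ≤ ‖B‖∞ ∫|γ_{Λ_L}A(Ũ) − μ_S(A)| dμ_S ≤ ‖B‖∞ C_A e^{−mL} ≤ C e^{−(m/2)t}`; small `t`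
by the trivial bound (`clustering_of_meanBoxInfluenceDecayHalfTorus_at`, rate `m/2`, `S₁ = 0`). -/
theorem stub_cruxOfMeanBoxInfluenceDecayHalfTorusNSC : (∀ (G : Type) [Group G] [TopologicalSpace G] [IsTopologicalGroup G] [CompactSpace G] [MeasurableSpace G] [BorelSpace G], Literature.MathematicalPhysics.QuantumFieldTheory.IsCompactSimpleLieGroup G → ¬ SimplyConnectedSpace G → ∀ r : Literature.MathematicalPhysics.QuantumFieldTheory.LatticeRep G, ∃ β₂ : ℝ, ∀ β : ℝ, β₂ ≤ β → ∃ m : ℝ, 0 < m ∧ ∀ A : Literature.MathematicalPhysics.QuantumFieldTheory.YMSpecies G, ∃ C : ℝ, ∀ (L S : ℕ), A.supp ⊆ ((Fintype.piFinset fun _ : Fin 4 => Finset.Icc (-((L : ℕ) : ℤ)) ((L : ℕ) : ℤ)) ×ˢ (Finset.univ : Finset (Fin 4))) → 2 * L + 1 ≤ S → ∫ V, |(∫ U, A.F U ∂(Literature.MathematicalPhysics.QuantumLattice.ymSpecification r.ρ β ((Fintype.piFinset fun _ : Fin 4 => Finset.Icc (-((L : ℕ) : ℤ)) ((L : ℕ)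 : ℤ)) ×ˢ (Finset.univ : Finset (Fin 4))) (Literature.MathematicalPhysics.QuantumLattice.torusLift (2 * S + 1) V))) - ∫ W, A.F (Literature.MathematicalPhysics.QuantumLattice.torusLift (2 * S + 1) W) ∂(Literature.MathematicalPhysics.QuantumFieldTheory.wilsonMeasure r.ρ β : MeasureTheory.Measure (Literature.MathematicalPhysics.QuantumFieldTheory.GaugeConfig 4 (2 * S + 1) G))| ∂(Literature.MathematicalPhysics.QuantumFieldTheory.wilsonMeasure r.ρ β : MeasureTheory.Measure (Literature.MathematicalPhysics.QuantumFieldTheory.GaugeConfig 4 (2 * S + 1) G)) ≤ C * Real.exp (-(m * L))) → Summit.QuantumFields.YangMills.Theses.ConvexGribovBody.NonSimplyConnectedLatticeGap := by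
  intro h G _ _ _ _ _ _ hG hnsc r
  obtain ⟨β₂, hβ₂⟩ := h G hG hnsc r
  refine ⟨β₂, fun β hβ => ?_⟩
  obtain ⟨m, hm, hAll⟩ := hβ₂ β hβ
  refine ⟨m / 2, half_pos hm, 0, fun A B => ?_⟩
  haveI : T2Space G := (r.continuous.isClosedEmbedding r.injective).isEmbedding.t2Space
  haveI : SecondCountableTopology G :=
    (r.continuous.isClosedEmbedding r.injective).isEmbedding.secondCountableTopology
  obtain ⟨C, hC⟩ := clustering_of_meanBoxInfluenceDecayHalfTorus_at r.ρ r.continuous β hm.le hAll A B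
  exact ⟨C, fun S n _ hn => hC S n hn⟩

end Summit.QuantumFields.YangMills.Theorems.NonSimplyConnectedLatticeGap

end
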